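import Mathlib
import Literature.Analysis.Calculus.HardyExteriorDecay
import HarnessLib

/-!
# Similarity-enstrophy tools: the backward ODE Liouville step and whole-space Hardy inequalities for
  decaying fields (pub-ns-dss theory T38-SCOPE pieces (S3) and (S2), LIOUVILLE-SIDE l.177; route
  `DssFarFieldSlaving`, crux `BlowupTypeIDssProfile`, stmt-NavierStokesRegularity-0155 — SUPPORT,
  label-free helper; cell pub-ns-dss, typer seat g6, 2026-08-23)

HONEST FRAMING. Folklore real analysis, typed as the first two pieces of the T38-SCOPE plan
(theory seat: S3 → S2 → S1 → S4) whose end product is a CONDITIONAL class corollary for the explicit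
rows T31″ / T34 / T38 of EXPLICIT-THRESHOLDS (conditional on the NAMED decay hypothesis (D); those
rows stay DERIVED until S1 + S4 land). Nothing here is specific to Navier–Stokes, nothing is
numerical, and nothing here bears on Navier–Stokes regularity or blow-up. Idea credit for the
Hardy-weighted stretching threshold: the OPEN item `StretchingWellBinding.DssProfileBinding`
(stmt-1578), which this file does not address.

CONTENTS.
* (S3) `eq_zero_of_deriv_le_neg_half_mul`: a non-negative, bounded, differentiable `Z : ℝ → ℝ`
  with `Z' ≤ −½ Z` vanishes identically (`Z e^{s/2}` is non-increasing and tends to `0` at `−∞`).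
  Consumer: the similarity enstrophy `Z(s) = ∫ |Ω(s)|²` of an ANCIENT solution lives on all of
  `s ∈ ℝ`, and threshold × Hardy give `½ Z' ≤ −¼ Z`.
* (S2) whole-space Hardy inequalities in dimension `3` for `C¹` functions WITHOUT compact support,
  under the decay `‖y‖ |u(y)| ≤ C₀` outside a ball (what (D) at `k = 1` delivers for the similarity
  vorticity): `hardy_sq_lintegral_le_of_decay` (`∫ u²/|y|² ≤ 4 ∫ |Du|²`, centre `0`),
  `hardy_sq_lintegral_sub_le_of_decay` (any centre `y₀`), and the componentwise vector form
  `hardy_sq_lintegral_le_of_decay_vec` (`∫ |Ω|²/|y|² ≤ 4 Σᵢ ∫ |DΩᵢ|² = 4 ∫ |DΩ|²_F`, the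
  `GaussianGapIdentities` spelling of the Frobenius norm), all as `ℝ≥0∞`-valued integrals. Proof:
  the tree's exterior Hardy inequality `hardy_sq_lintegral_exterior_le_of_integrable`
  (`HardyExteriorDecay`) on `{‖y‖ > R}` for every `R > 0` and `R ↓ 0` by monotone convergence
  (`{0}` is Lebesgue-null); integrability on each exterior region from continuity on the annulus
  and the decay tail (`lintegral_sq_div_norm_sq_exterior_lt_top`).
[this file; theory T38-SCOPE (S2)/(S3); (α) theory g9 2026-08-23T08:17:56Z]
-/

noncomputable section

set_option linter.dupNamespace false

namespace Summit.NavierStokesRegularity.NavierStokesRegularity.Theorems.SimilarityEnstrophy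

open MeasureTheory Set Filter Topology Module Metric
open scoped ENNReal
open Literature.Analysis.Calculus

/-- **ODE Liouville lemma (T38-SCOPE (S3)).** A non-negative differentiable function `Z` on `ℝ`,
bounded above, with `Z' ≤ −½ Z` everywhere, vanishes identically: `W(s) = Z(s) e^{s/2}` is
non-increasing, so `W(s) ≤ W(s₀) ≤ B e^{s₀/2} → 0` as `s₀ → −∞`. (The similarity enstrophy of an
ancient solution lives on all of `s ∈ ℝ`.) [folklore] -/
theorem eq_zero_of_deriv_le_neg_half_mul {Z : ℝ → ℝ} (hd : Differentiable ℝ Z)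
    (hZ0 : ∀ s, 0 ≤ Z s) (hbdd : ∃ B, ∀ s, Z s ≤ B) (hZ' : ∀ s, deriv Z s ≤ -(1 / 2) * Z s) :
    ∀ s, Z s = 0 := by
  obtain ⟨B, hB⟩ := hbdd
  set W : ℝ → ℝ := fun s => Z s * Real.exp (s / 2) with hW
  have hWd : Differentiable ℝ W := hd.mul ((differentiable_id.div_const 2).exp)
  have hW' : ∀ s, deriv W s ≤ 0 := by
    intro s
    have h1 : HasDerivAt (fun s => Real.exp (s / 2)) (Real.exp (s / 2) * (1 / 2)) s := by
      have := ((hasDerivAt_id s).div_const 2).exp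
      simpa using this
    have h2 : HasDerivAt W (deriv Z s * Real.exp (s / 2) + Z s * (Real.exp (s / 2) * (1 / 2))) s :=
      (hd s).hasDerivAt.mul h1
    rw [h2.deriv]
    have hexp : 0 < Real.exp (s / 2) := Real.exp_pos _
    nlinarith [hZ' s, hZ0 s]
  have hanti : Antitone W := antitone_of_deriv_nonpos hWd hW'
  intro s
  have hWs0 : 0 ≤ W s := mul_nonneg (hZ0 s) (Real.exp_pos _).le
  -- `W s ≤ B e^{s₀/2}` for every `s₀ ≤ s`, and the right side tends to `0` as `s₀ → −∞`
  have hle : ∀ s₀ ≤ s, W s ≤ B * Real.exp (s₀ / 2) := fun s₀ hs₀ =>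
    (hanti hs₀).trans (mul_le_mul_of_nonneg_right (hB s₀) (Real.exp_pos _).le)
  have hlim : Tendsto (fun s₀ : ℝ => B * Real.exp (s₀ / 2)) atBot (𝓝 0) := by
    have h := (Real.tendsto_exp_atBot.comp (tendsto_id.atBot_div_const (by norm_num : (0:ℝ) < 2)))
    simpa using h.const_mul B
  have hWle : W s ≤ 0 :=
    ge_of_tendsto hlim (eventually_atBot.2 ⟨s, fun s₀ hs₀ => hle s₀ hs₀⟩)
  have hW0 : W s = 0 := le_antisymm hWle hWs0
  have := mul_eq_zero.1 hW0
  rcases this with h | h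
  · exact h
  · exact absurd h (Real.exp_pos _).ne'

variable {E : Type*} [NormedAddCommGroup E] [InnerProductSpace ℝ E] [FiniteDimensional ℝ E]
  [MeasurableSpace E] [BorelSpace E]

/-- Integrability of `u²/‖y‖²` on every exterior region `{‖y‖ > R}`, `R > 0`, for a continuous `u`
with the decay `‖y‖ |u(y)| ≤ C₀` outside a ball of radius `R₁` (dimension `3`): bounded integrand on
the annulus `R < ‖y‖ ≤ R₁`, decay outside. [folklore] -/
theorem lintegral_sq_div_norm_sq_exterior_lt_top (hE : finrank ℝ E = 3) {u : E → ℝ}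
    (hu : Continuous u) {R₁ C₀ : ℝ} (hR₁ : 0 < R₁) (hdec : ∀ y : E, R₁ < ‖y‖ → ‖y‖ * |u y| ≤ C₀)
    {R : ℝ} (hR : 0 < R) :
    ∫⁻ y in {y : E | R < ‖y‖}, ENNReal.ofReal (u y ^ 2 / ‖y‖ ^ 2) < ⊤ := by
  obtain ⟨M, hM⟩ := (isCompact_closedBall (0 : E) R₁).exists_bound_of_continuousOn
    hu.continuousOn
  set A : Set E := {y : E | R < ‖y‖} ∩ closedBall (0 : E) R₁ with hA
  set B : Set E := {y : E | R₁ < ‖y‖} with hB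
  have hsub : {y : E | R < ‖y‖} ⊆ A ∪ B := by
    intro y hy
    by_cases h : ‖y‖ ≤ R₁
    · exact Or.inl ⟨hy, mem_closedBall_zero_iff.2 h⟩
    · exact Or.inr (lt_of_not_ge h)
  have hAbd : ∀ y ∈ A, ENNReal.ofReal (u y ^ 2 / ‖y‖ ^ 2) ≤ ENNReal.ofReal (M ^ 2 / R ^ 2) := by
    rintro y ⟨hyR, hyB⟩
    refine ENNReal.ofReal_le_ofReal ?_
    have hyR' : R < ‖y‖ := hyR
    have hMy : |u y| ≤ M := by simpa [Real.norm_eq_abs] using hM y hyB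
    have hM0 : 0 ≤ M := (abs_nonneg _).trans hMy
    have h1 : u y ^ 2 ≤ M ^ 2 := by
      rw [← sq_abs]; exact pow_le_pow_left₀ (abs_nonneg _) hMy 2
    have h2 : R ^ 2 ≤ ‖y‖ ^ 2 := pow_le_pow_left₀ hR.le hyR'.le 2
    exact div_le_div₀ (sq_nonneg M) h1 (pow_pos hR 2) h2
  have hAm : MeasurableSet A :=
    ((isOpen_lt continuous_const continuous_norm).measurableSet).inter measurableSet_closedBall
  have hA_lt : ∫⁻ y in A, ENNReal.ofReal (u y ^ 2 / ‖y‖ ^ 2) < ⊤ := by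
    calc ∫⁻ y in A, ENNReal.ofReal (u y ^ 2 / ‖y‖ ^ 2)
        ≤ ∫⁻ _ in A, ENNReal.ofReal (M ^ 2 / R ^ 2) := setLIntegral_mono' hAm hAbd
      _ = ENNReal.ofReal (M ^ 2 / R ^ 2) * volume A := setLIntegral_const _ _
      _ < ⊤ := ENNReal.mul_lt_top ENNReal.ofReal_lt_top
          (lt_of_le_of_lt (measure_mono inter_subset_right) measure_closedBall_lt_top)
  have hB_lt : ∫⁻ y in B, ENNReal.ofReal (u y ^ 2 / ‖y‖ ^ 2) < ⊤ :=
    lintegral_sq_div_norm_sq_lt_top_of_decay hE hR₁ hdec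
  calc ∫⁻ y in {y : E | R < ‖y‖}, ENNReal.ofReal (u y ^ 2 / ‖y‖ ^ 2)
      ≤ ∫⁻ y in A ∪ B, ENNReal.ofReal (u y ^ 2 / ‖y‖ ^ 2) := lintegral_mono_set hsub
    _ ≤ (∫⁻ y in A, ENNReal.ofReal (u y ^ 2 / ‖y‖ ^ 2)) +
          ∫⁻ y in B, ENNReal.ofReal (u y ^ 2 / ‖y‖ ^ 2) := lintegral_union_le _ _ _
    _ < ⊤ := ENNReal.add_lt_top.2 ⟨hA_lt, hB_lt⟩

/-- **Whole-space Hardy inequality for decaying `C¹` functions, dimension 3 (T38-SCOPE (S2), scalar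
form):** for `u ∈ C¹(E)` with `‖y‖ |u(y)| ≤ C₀` outside some ball,
`∫ u²/‖y‖² ≤ 4 ∫ ‖Du‖²` (as `ℝ≥0∞`-valued integrals; no compact support). Proof: the tree's exterior
Hardy inequality `hardy_sq_lintegral_exterior_le_of_integrable` on `{‖y‖ > R}` for every `R > 0`
and `R ↓ 0` by monotone convergence (`{0}` is null). [folklore] -/
theorem hardy_sq_lintegral_le_of_decay (hE : finrank ℝ E = 3) {u : E → ℝ} (hu : ContDiff ℝ 1 u)
    {R₁ C₀ : ℝ} (hR₁ : 0 < R₁) (hdec : ∀ y : E, R₁ < ‖y‖ → ‖y‖ * |u y| ≤ C₀) :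
    ∫⁻ y, ENNReal.ofReal (u y ^ 2 / ‖y‖ ^ 2) ≤ 4 * ∫⁻ y, ENNReal.ofReal (‖fderiv ℝ u y‖ ^ 2) := by
  set F : E → ℝ≥0∞ := fun y => ENNReal.ofReal (u y ^ 2 / ‖y‖ ^ 2) with hF
  set G : E → ℝ≥0∞ := fun y => ENNReal.ofReal (‖fderiv ℝ u y‖ ^ 2) with hG
  have hc4 : ENNReal.ofReal ((2 / ((finrank ℝ E : ℝ) - 2)) ^ 2) = 4 := by rw [hE]; norm_num
  -- exterior Hardy on every `{‖y‖ > R}`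
  have hext : ∀ R : ℝ, 0 < R → ∫⁻ y in {y : E | R < ‖y‖}, F y ≤ 4 * ∫⁻ y, G y := by
    intro R hR
    have h := hardy_sq_lintegral_exterior_le_of_integrable (u := u) (R₀ := 0) hR hR
      (fun y _ => hu.contDiffAt)
          (lintegral_sq_div_norm_sq_exterior_lt_top hE hu.continuous hR₁ hdec hR)
      hE.ge
    rw [hc4] at h
    exact h.trans (mul_le_mul_right (setLIntegral_le_lintegral _ _) _)
  -- exhaust `{0}ᶜ` by the regions `{‖y‖ > R₁/(n+1)}`
  set S : ℕ → Set E := fun n => {y : E | R₁ / ((n : ℝ) + 1) < ‖y‖} with hS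
  have hdir : Directed (· ⊆ ·) S := by
    refine Monotone.directed_le fun m n hmn y hy => ?_
    have hy' : R₁ / ((m : ℝ) + 1) < ‖y‖ := hy
    have hle : R₁ / ((n : ℝ) + 1) ≤ R₁ / ((m : ℝ) + 1) :=
      div_le_div_of_nonneg_left hR₁.le (by positivity) (by exact_mod_cast Nat.succ_le_succ hmn)
    exact lt_of_le_of_lt hle hy'
  have hU : (⋃ n, S n) = {(0 : E)}ᶜ := by
    ext y
    simp only [mem_iUnion, mem_compl_iff, mem_singleton_iff, hS, mem_setOf_eq]
    constructor
    · rintro ⟨n, hn⟩ rfl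
      rw [norm_zero] at hn
      exact absurd hn (not_lt.2 (by positivity))
    · intro hy
      have hpos : 0 < ‖y‖ := norm_pos_iff.2 hy
      obtain ⟨n, hn⟩ := exists_nat_gt (R₁ / ‖y‖)
      refine ⟨n, ?_⟩
      rw [div_lt_iff₀ (by positivity)]
      rw [div_lt_iff₀ hpos] at hn
      nlinarith
  haveI : Nontrivial E := Module.nontrivial_of_finrank_pos (R := ℝ) (by rw [hE]; norm_num)
  have hae : ({(0 : E)}ᶜ : Set E) =ᵐ[volume] (univ : Set E) := by
    rw [ae_eq_univ, compl_compl]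
    exact measure_singleton 0
  calc ∫⁻ y, F y = ∫⁻ y in {(0 : E)}ᶜ, F y := by
        rw [setLIntegral_congr hae, setLIntegral_univ]
    _ = ⨆ n, ∫⁻ y in S n, F y := by rw [← hU, setLIntegral_iUnion_of_directed _ hdir]
    _ ≤ 4 * ∫⁻ y, G y := iSup_le fun n => hext _ (by positivity)

/-- Hardy about an arbitrary centre `y₀` (translate). [folklore] -/
theorem hardy_sq_lintegral_sub_le_of_decay (hE : finrank ℝ E = 3) {u : E → ℝ} (hu : ContDiff ℝ 1 u)
    (y₀ : E) {R₁ C₀ : ℝ} (hR₁ : 0 < R₁)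
    (hdec : ∀ y : E, R₁ < ‖y - y₀‖ → ‖y - y₀‖ * |u y| ≤ C₀) :
    ∫⁻ y, ENNReal.ofReal (u y ^ 2 / ‖y - y₀‖ ^ 2) ≤
      4 * ∫⁻ y, ENNReal.ofReal (‖fderiv ℝ u y‖ ^ 2) := by
  have hv : ContDiff ℝ 1 fun y => u (y + y₀) := hu.comp (contDiff_id.add contDiff_const)
  have hdec' : ∀ y : E, R₁ < ‖y‖ → ‖y‖ * |u (y + y₀)| ≤ C₀ := fun y hy => by
    simpa only [add_sub_cancel_right] using hdec (y + y₀)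
        (by simpa only [add_sub_cancel_right] using hy)
  have h := hardy_sq_lintegral_le_of_decay hE hv hR₁ hdec'
  have h1 : ∫⁻ y, ENNReal.ofReal (u (y + y₀) ^ 2 / ‖y‖ ^ 2) =
      ∫⁻ y, ENNReal.ofReal (u y ^ 2 / ‖y - y₀‖ ^ 2) := by
    have := lintegral_sub_right_eq_self (μ := (volume : Measure E))
      (fun y => ENNReal.ofReal (u (y + y₀) ^ 2 / ‖y‖ ^ 2)) y₀
    simpa only [sub_add_cancel] using this.symm
  have h2 : ∫⁻ y, ENNReal.ofReal (‖fderiv ℝ (fun y => u (y + y₀)) y‖ ^ 2) =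
      ∫⁻ y, ENNReal.ofReal (‖fderiv ℝ u y‖ ^ 2) := by
    simp_rw [fderiv_comp_add_right]
    have := lintegral_sub_right_eq_self (μ := (volume : Measure E))
      (fun y => ENNReal.ofReal (‖fderiv ℝ u (y + y₀)‖ ^ 2)) y₀
    simpa only [sub_add_cancel] using this.symm
  rw [h1, h2] at h
  exact h

/-- **Hardy for vector fields, componentwise (T38-SCOPE (S2)):** for `Ω : ℝ³ → ℝ³` of class `C¹`
with `‖y‖ ‖Ω(y)‖ ≤ C₀` outside a ball, `∫ ‖Ω‖²/‖y‖² ≤ 4 Σᵢ ∫ ‖D Ωᵢ‖²` (`= 4 ∫ ‖DΩ‖²_F`), as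
`ℝ≥0∞`-valued integrals: `‖Ω‖² = Σᵢ Ωᵢ²` and the scalar inequality component by component (this avoids
the non-smoothness of `|Ω|`). [folklore] -/
theorem hardy_sq_lintegral_le_of_decay_vec
    {Ω : EuclideanSpace ℝ (Fin 3) → EuclideanSpace ℝ (Fin 3)} (hΩ : ContDiff ℝ 1 Ω)
    {R₁ C₀ : ℝ} (hR₁ : 0 < R₁)
    (hdec : ∀ y : EuclideanSpace ℝ (Fin 3), R₁ < ‖y‖ → ‖y‖ * ‖Ω y‖ ≤ C₀) :
    ∫⁻ y, ENNReal.ofReal (‖Ω y‖ ^ 2 / ‖y‖ ^ 2) ≤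
      4 * ∑ i, ∫⁻ y, ENNReal.ofReal (‖fderiv ℝ (fun z => Ω z i) y‖ ^ 2) := by
  have hE : finrank ℝ (EuclideanSpace ℝ (Fin 3)) = 3 := finrank_euclideanSpace_fin
  -- components
  have hci : ∀ i : Fin 3, ContDiff ℝ 1 (fun z => Ω z i) := fun i => contDiff_euclidean.1 hΩ i
  have hdeci : ∀ i : Fin 3, ∀ y : EuclideanSpace ℝ (Fin 3), R₁ < ‖y‖ → ‖y‖ * |Ω y i| ≤ C₀ := by
    intro i y hy
    have h1 : |Ω y i| ≤ ‖Ω y‖ := by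
      rw [← Real.norm_eq_abs]; exact PiLp.norm_apply_le (Ω y) i
    exact (mul_le_mul_of_nonneg_left h1 (norm_nonneg _)).trans (hdec y hy)
  have hcomp : ∀ i : Fin 3, ∫⁻ y, ENNReal.ofReal ((Ω y i) ^ 2 / ‖y‖ ^ 2) ≤
      4 * ∫⁻ y, ENNReal.ofReal (‖fderiv ℝ (fun z => Ω z i) y‖ ^ 2) := fun i =>
    hardy_sq_lintegral_le_of_decay hE (hci i) hR₁ (hdeci i)
  -- `‖Ω y‖²/‖y‖² = Σᵢ Ωᵢ(y)²/‖y‖²`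
  have hsplit : ∀ y : EuclideanSpace ℝ (Fin 3), ENNReal.ofReal (‖Ω y‖ ^ 2 / ‖y‖ ^ 2) =
      ∑ i, ENNReal.ofReal ((Ω y i) ^ 2 / ‖y‖ ^ 2) := by
    intro y
    rw [EuclideanSpace.norm_sq_eq, ← ENNReal.ofReal_sum_of_nonneg (fun i _ => by positivity),
      Finset.sum_div]
    simp only [Real.norm_eq_abs, sq_abs]
  have hmeas : ∀ i : Fin 3, Measurable fun y : EuclideanSpace ℝ (Fin 3) =>
      ENNReal.ofReal ((Ω y i) ^ 2 / ‖y‖ ^ 2) := fun i =>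
    (((hci i).continuous.measurable.pow_const 2).div
      (continuous_norm.measurable.pow_const 2)).ennreal_ofReal
  calc ∫⁻ y, ENNReal.ofReal (‖Ω y‖ ^ 2 / ‖y‖ ^ 2)
      = ∫⁻ y, ∑ i, ENNReal.ofReal ((Ω y i) ^ 2 / ‖y‖ ^ 2) := lintegral_congr fun y => hsplit y
    _ = ∑ i, ∫⁻ y, ENNReal.ofReal ((Ω y i) ^ 2 / ‖y‖ ^ 2) :=
        lintegral_finsetSum _ fun i _ => hmeas i
    _ ≤ ∑ i, 4 * ∫⁻ y, ENNReal.ofReal (‖fderiv ℝ (fun z => Ω z i) y‖ ^ 2) :=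
        Finset.sum_le_sum fun i _ => hcomp i
    _ = 4 * ∑ i, ∫⁻ y, ENNReal.ofReal (‖fderiv ℝ (fun z => Ω z i) y‖ ^ 2) := by
        rw [Finset.mul_sum]

end Summit.NavierStokesRegularity.NavierStokesRegularity.Theorems.SimilarityEnstrophy
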